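import Literature.NumberTheory.EllipticCurves.PAdicPowerSeriesInterpolationAgreementProofs
import Literature.NumberTheory.EllipticCurves.CyclotomicInterpolantUniquenessProofs
import HarnessLib

/-!
# Factorisation of a bounded interpolant through a product — constant in `ℂ_p` (proofs only)

Topic `Literature/NumberTheory/EllipticCurves`, namespace `Literature.NumberTheory.EllipticCurves`.
THEOREMS ONLY (no definition, no named fact; D-0014, D-0026). Companion of
`PAdicPowerSeriesInterpolationAgreementProofs` (`MemIwasawaRat.eq_C_mul_mul_of_forall_hasSum`: if
`G, B₁, B₂ ∈ Λ ⊗ ℚ_p` and `G = c · B₁ · B₂` at `T = χ(γ) - 1` for the primitive characters `χ` of `Γ`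
of conductor `p^{k+3}`, with `c ∈ ℚ_p`, then `G = c B₁ B₂`). When two `p`-adic `L`-functions are
compared through interpolation formulas involving COMPLEX periods moved to `ℂ_p` along a field
isomorphism `ι : ℂ ≅ ℂ_p` (Hsieh / Disegni frame), the proportionality constant `c` is a priori an
element of `ℂ_p`, not of `ℚ_p`; the uniqueness principle of `Λ ⊗ ℚ_p` (Weierstrass preparation, one
zero per conductor) does not apply to `G - c B₁ B₂ ∈ ℂ_p⟦T⟧`, but the tree's BOUNDED-interpolant
uniqueness over `ℂ_p` does (`eq_zero_of_bounded_of_forall_character_hasSum_zero`,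
`CyclotomicInterpolantUniquenessProofs`: all characters of all conductors AND the constant term). This
file proves that version:

* `not_isPrimitive_of_orderOf_eq_prime_pow` — there is no primitive Dirichlet character modulo `p` of
  `p`-power order (its order divides `p - 1`), so the conductor-`p` level of the uniqueness hypothesis
  is vacuous;
* `norm_coeff_mul_le_mul_of_ultrametric` — coefficients of a product of two coefficient-bounded power series over
  `ℂ_p` are bounded (ultrametric inequality);
* `MemIwasawaRat.map_eq_C_mul_mul_of_forall_hasSum` — **if `G(0) = c B₁(0) B₂(0)` and
  `G(χ(γ)-1) = c B₁(χ(γ)-1) B₂(χ(γ)-1)` for every primitive even `p`-power-order `χ` modulo `p^{m+2}`,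
  all `m`, with `c ∈ ℂ_p`, then `ι(G) = c · ι(B₁) · ι(B₂)` in `ℂ_p⟦T⟧`** (`ι = algebraMap ℚ_p ℂ_p` on
  coefficients);
* `MemIwasawaRat.map_coeff_one_eq_of_forall_hasSum` — the leading-term corollary when `B₁(0) = 0`:
  `ι([T¹]G) = c · ι([T¹]B₁) · ι(B₂(0))`.

References: B. Mazur, J. Tate, J. Teitelbaum, Invent. Math. 84 (1986) §I.11, §I.14 (14.3)
[MazurTateTeitelbaum1986Invent]; M.-L. Hsieh, Doc. Math. 19 (2014) (the `ι : ℂ ≅ ℂ_p` frame)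
[Hsieh2014]; D. Disegni, Compos. Math. 153 (2017) Thm. A, Lemma 10.2.2 [Disegni2017].
-/

noncomputable section

open Filter Topology

namespace Literature.NumberTheory.EllipticCurves

variable {p : ℕ} [Fact p.Prime]

/-- **No primitive character of `p`-power order modulo `p`.** A Dirichlet character `χ` modulo `p`
satisfies `χ^{p-1} = 1` (`a^{p-1} = 1` in `(ℤ/p)^×`), so if its order is a power of `p` it is trivial,
and the trivial character has conductor `1 ≠ p` (Washington GTM 83 §3; MTT §I.13: the characters of `Γ`
have conductor `1` or `≥ p^{e₀+1}`). [cite: Washington1997, §3 (conductors of Dirichlet characters)] -/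
theorem not_isPrimitive_of_orderOf_eq_prime_pow {R : Type*} [CommRing R] [IsDomain R]
    (χ : DirichletCharacter R (p ^ 1)) (hord : ∃ j : ℕ, orderOf χ = p ^ j) : ¬ χ.IsPrimitive := by
  have hp : p.Prime := Fact.out
  haveI : Fact (Nat.Prime (p ^ 1)) := ⟨by rw [pow_one]; exact hp⟩
  obtain ⟨j, hj⟩ := hord
  -- `χ ^ (p - 1) = 1`
  have hpow : χ ^ (p ^ 1 - 1) = 1 := by
    ext a
    have ha : ((a : ZMod (p ^ 1)) ^ (p ^ 1 - 1)) = 1 := ZMod.pow_card_sub_one_eq_one (Units.ne_zero a)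
    rw [MulChar.pow_apply_coe, MulChar.one_apply_coe, ← map_pow, ha, map_one]
  have hdvd : p ^ j ∣ p ^ 1 - 1 := by rw [← hj]; exact orderOf_dvd_of_pow_eq_one hpow
  have hj0 : j = 0 := by
    by_contra hj0
    have hpd : p ∣ p ^ 1 - 1 := (dvd_pow_self p hj0).trans hdvd
    have hp1 : p ∣ p ^ 1 := by rw [pow_one]
    have h1 : p ∣ 1 := by
      have := Nat.dvd_sub hp1 hpd
      rwa [Nat.sub_sub_self (Nat.one_le_pow _ _ hp.pos)] at this
    exact hp.one_lt.ne' (Nat.dvd_one.mp h1)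
  rw [hj0, pow_zero, orderOf_eq_one_iff] at hj
  rw [hj, DirichletCharacter.isPrimitive_def, DirichletCharacter.conductor_one, pow_one]
  exact hp.one_lt.ne

/-- **Coefficients of a product of bounded power series over `ℂ_p` are bounded**:
`‖[T^k](A B)‖ ≤ C₁ C₂` when `‖[T^i]A‖ ≤ C₁`, `‖[T^j]B‖ ≤ C₂` (ultrametric inequality on the finite sum
`∑_{i+j=k} a_i b_j`). [cite: Washington1997, §7.1 (Λ ⊗ ℚ_p and bounded power series)] -/
theorem norm_coeff_mul_le_mul_of_ultrametric {A B : PowerSeries ℂ_[p]} {C₁ C₂ : ℝ}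
    (hA : ∀ i, ‖PowerSeries.coeff i A‖ ≤ C₁) (hB : ∀ j, ‖PowerSeries.coeff j B‖ ≤ C₂) (k : ℕ) :
    ‖PowerSeries.coeff k (A * B)‖ ≤ C₁ * C₂ := by
  have hC₁ : 0 ≤ C₁ := (norm_nonneg _).trans (hA 0)
  have hC₂ : 0 ≤ C₂ := (norm_nonneg _).trans (hB 0)
  rw [PowerSeries.coeff_mul]
  refine IsUltrametricDist.norm_sum_le_of_forall_le_of_nonneg (mul_nonneg hC₁ hC₂) fun ij _ ↦ ?_
  rw [norm_mul]
  exact mul_le_mul (hA _) (hB _) (norm_nonneg _) hC₁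

/-- The coefficients of `ι(L)`, `L ∈ Λ ⊗ ℚ_p`, `ι = algebraMap ℚ_p ℂ_p`, are bounded.
[cite: MazurTateTeitelbaum1986Invent, §I.12] -/
theorem MemIwasawaRat.exists_norm_coeff_map_le {L : PowerSeries ℚ_[p]} (hL : MemIwasawaRat p L) :
    ∃ C : ℝ, ∀ k, ‖PowerSeries.coeff k (PowerSeries.map (algebraMap ℚ_[p] ℂ_[p]) L)‖ ≤ C := by
  obtain ⟨C, hC⟩ := hL.exists_norm_coeff_le
  exact ⟨C, fun k ↦ by rw [PowerSeries.coeff_map, norm_algebraMap']; exact hC k⟩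

/-- Evaluation of a coefficient-bounded `ℂ_p`-power series at `|z| < 1` is summable. [cite: Washington1997, §7.2] -/
theorem summable_coeff_mul_pow_of_le {A : PowerSeries ℂ_[p]} {C : ℝ} (hA : ∀ i, ‖PowerSeries.coeff i A‖ ≤ C)
    {z : ℂ_[p]} (hz : ‖z‖ < 1) : Summable fun k ↦ PowerSeries.coeff k A * z ^ k :=
  summable_map_coeff_mul_pow (RingHom.id ℂ_[p]) (fun k ↦ by rw [RingHom.id_apply]; exact hA k) hz

/-- Evaluation of coefficient-bounded `ℂ_p`-power series at `|z| < 1` is multiplicative (`HasSum` form).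
[cite: Washington1997, §7.2] -/
theorem hasSum_coeff_mul_mul_pow_of_le {A B : PowerSeries ℂ_[p]} {C₁ C₂ : ℝ}
    (hA : ∀ i, ‖PowerSeries.coeff i A‖ ≤ C₁) (hB : ∀ j, ‖PowerSeries.coeff j B‖ ≤ C₂)
    {z : ℂ_[p]} (hz : ‖z‖ < 1) {v₁ v₂ : ℂ_[p]}
    (hv₁ : HasSum (fun k ↦ PowerSeries.coeff k A * z ^ k) v₁)
    (hv₂ : HasSum (fun k ↦ PowerSeries.coeff k B * z ^ k) v₂) :
    HasSum (fun k ↦ PowerSeries.coeff k (A * B) * z ^ k) (v₁ * v₂) := by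
  have hA' : ∀ k, ‖(RingHom.id ℂ_[p]) (PowerSeries.coeff k A)‖ ≤ C₁ := fun k ↦ hA k
  have hB' : ∀ k, ‖(RingHom.id ℂ_[p]) (PowerSeries.coeff k B)‖ ≤ C₂ := fun k ↦ hB k
  have hprod := tsum_map_coeff_mul_mul_pow (RingHom.id ℂ_[p]) hA' hB' hz
  simp only [RingHom.id_apply] at hprod
  rw [hv₁.tsum_eq, hv₂.tsum_eq] at hprod
  rw [← hprod]
  exact (summable_coeff_mul_pow_of_le (norm_coeff_mul_le_mul_of_ultrametric hA hB) hz).hasSum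

/-- **Factorisation with a constant in `ℂ_p`.** Let `G, B₁, B₂ ∈ Λ ⊗ ℚ_p`, `c ∈ ℂ_p`, `ι = algebraMap
ℚ_p ℂ_p`. Suppose `ι(G(0)) = c · ι(B₁(0)) · ι(B₂(0))` and that for every `m` and every primitive even
Dirichlet character `χ` modulo `p^{m+2}` of `p`-power order with values in `ℂ_p`, whenever
`B₁(χ(γ)-1) = v₁` and `B₂(χ(γ)-1) = v₂` then `G(χ(γ)-1) = c · v₁ · v₂`. Then `ι(G) = c · ι(B₁) · ι(B₂)`
in `ℂ_p⟦T⟧`. Proof: `D = ι(G) - c ι(B₁) ι(B₂)` is bounded, has constant term `0`, and vanishes at every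
`χ(γ) - 1` (conductor `p` being vacuous: `not_isPrimitive_of_orderOf_eq_prime_pow`), hence is `0` by the
bounded-interpolant uniqueness over `ℂ_p` (Mazur–Tate–Teitelbaum §I.11/§I.14: a `p`-adic
`L`-function is a MEASURE, determined by its interpolation property). [cite: MazurTateTeitelbaum1986Invent, §I.11 and §I.14 (14.3)]
[cite: Disegni2017, Lemma 10.2.2 (factorisation of the cyclotomic restriction)] -/
theorem MemIwasawaRat.map_eq_C_mul_mul_of_forall_hasSum {G B₁ B₂ : PowerSeries ℚ_[p]}
    (hG : MemIwasawaRat p G) (hB₁ : MemIwasawaRat p B₁) (hB₂ : MemIwasawaRat p B₂) (c : ℂ_[p])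
    (h0 : algebraMap ℚ_[p] ℂ_[p] (PowerSeries.constantCoeff G) =
      c * algebraMap ℚ_[p] ℂ_[p] (PowerSeries.constantCoeff B₁) *
        algebraMap ℚ_[p] ℂ_[p] (PowerSeries.constantCoeff B₂))
    (h : ∀ (m : ℕ) (χ : DirichletCharacter ℂ_[p] (p ^ (m + 2))), χ.IsPrimitive → χ.Even →
      (∃ j : ℕ, orderOf χ = p ^ j) → ∀ v₁ v₂ : ℂ_[p],
        HasSum (fun i ↦ algebraMap ℚ_[p] ℂ_[p] (PowerSeries.coeff i B₁) *
          (χ (cyclotomicGenerator p : ZMod (p ^ (m + 2))) - 1) ^ i) v₁ →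
        HasSum (fun i ↦ algebraMap ℚ_[p] ℂ_[p] (PowerSeries.coeff i B₂) *
          (χ (cyclotomicGenerator p : ZMod (p ^ (m + 2))) - 1) ^ i) v₂ →
        HasSum (fun i ↦ algebraMap ℚ_[p] ℂ_[p] (PowerSeries.coeff i G) *
          (χ (cyclotomicGenerator p : ZMod (p ^ (m + 2))) - 1) ^ i) (c * v₁ * v₂)) :
    PowerSeries.map (algebraMap ℚ_[p] ℂ_[p]) G =
      PowerSeries.C c * PowerSeries.map (algebraMap ℚ_[p] ℂ_[p]) B₁ *
        PowerSeries.map (algebraMap ℚ_[p] ℂ_[p]) B₂ := by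
  set ι := algebraMap ℚ_[p] ℂ_[p] with hι
  set P : PowerSeries ℂ_[p] := PowerSeries.C c * PowerSeries.map ι B₁ * PowerSeries.map ι B₂ with hP
  -- bounds
  obtain ⟨CG, hCG⟩ := hG.exists_norm_coeff_map_le
  obtain ⟨C₁, hC₁⟩ := hB₁.exists_norm_coeff_map_le
  obtain ⟨C₂, hC₂⟩ := hB₂.exists_norm_coeff_map_le
  have hcB₁ : ∀ i, ‖PowerSeries.coeff i (PowerSeries.C c * PowerSeries.map ι B₁)‖ ≤ ‖c‖ * C₁ := fun i ↦ by
    rw [PowerSeries.coeff_C_mul, norm_mul]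
    exact mul_le_mul_of_nonneg_left (hC₁ i) (norm_nonneg _)
  have hPb : ∀ k, ‖PowerSeries.coeff k P‖ ≤ ‖c‖ * C₁ * C₂ := norm_coeff_mul_le_mul_of_ultrametric hcB₁ hC₂
  set D : PowerSeries ℂ_[p] := PowerSeries.map ι G - P with hD
  have hDb : ∀ k, ‖(RingHom.id ℂ_[p]) (PowerSeries.coeff k D)‖ ≤ max CG (‖c‖ * C₁ * C₂) := fun k ↦ by
    rw [RingHom.id_apply, hD, map_sub, sub_eq_add_neg]
    refine (IsUltrametricDist.norm_add_le_max _ _).trans ?_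
    rw [norm_neg]
    exact max_le_max (hCG k) (hPb k)
  -- constant term
  have hcc : ∀ L : PowerSeries ℚ_[p], PowerSeries.constantCoeff (PowerSeries.map ι L) =
      ι (PowerSeries.constantCoeff L) := fun L ↦ by
    rw [← PowerSeries.coeff_zero_eq_constantCoeff_apply, PowerSeries.coeff_map,
      PowerSeries.coeff_zero_eq_constantCoeff_apply]
  have hD0 : PowerSeries.constantCoeff D = 0 := by
    rw [hD, map_sub, hP, map_mul, map_mul, PowerSeries.constantCoeff_C, hcc, hcc, hcc, h0, sub_self]
  -- vanishing at the characters
  have hDz : ∀ m : ℕ, 0 < m → ∀ χ : DirichletCharacter ℂ_[p] (p ^ m), χ.IsPrimitive → χ.Even →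
      (∃ j : ℕ, orderOf χ = p ^ j) →
        HasSum (fun i ↦ (RingHom.id ℂ_[p]) (PowerSeries.coeff i D) *
          (χ (cyclotomicGenerator p : ZMod (p ^ m)) - 1) ^ i) 0 := by
    intro m hm χ hχ heven hord
    match m, hm with
    | 1, _ => exact absurd hχ (not_isPrimitive_of_orderOf_eq_prime_pow χ hord)
    | m + 2, _ =>
      have hz : ‖χ (cyclotomicGenerator p : ZMod (p ^ (m + 2))) - 1‖ < 1 :=
        norm_apply_cyclotomicGenerator_sub_one_lt χ hord
      obtain ⟨v₁, hv₁⟩ := hB₁.summable_eval hz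
      obtain ⟨v₂, hv₂⟩ := hB₂.summable_eval hz
      have hGv := h m χ hχ heven hord v₁ v₂ hv₁ hv₂
      -- the product side evaluates to `c v₁ v₂`
      have hv₁' : HasSum (fun k ↦ PowerSeries.coeff k (PowerSeries.C c * PowerSeries.map ι B₁) *
          (χ (cyclotomicGenerator p : ZMod (p ^ (m + 2))) - 1) ^ k) (c * v₁) := by
        have heq : (fun k ↦ PowerSeries.coeff k (PowerSeries.C c * PowerSeries.map ι B₁) *
            (χ (cyclotomicGenerator p : ZMod (p ^ (m + 2))) - 1) ^ k) =
            fun k ↦ c * (ι (PowerSeries.coeff k B₁) *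
              (χ (cyclotomicGenerator p : ZMod (p ^ (m + 2))) - 1) ^ k) := by
          funext k
          rw [PowerSeries.coeff_C_mul, PowerSeries.coeff_map, mul_assoc]
        rw [heq]
        exact hv₁.mul_left c
      have hv₂' : HasSum (fun k ↦ PowerSeries.coeff k (PowerSeries.map ι B₂) *
          (χ (cyclotomicGenerator p : ZMod (p ^ (m + 2))) - 1) ^ k) v₂ := by
        simp only [PowerSeries.coeff_map]
        exact hv₂
      have hPv : HasSum (fun k ↦ PowerSeries.coeff k P *
          (χ (cyclotomicGenerator p : ZMod (p ^ (m + 2))) - 1) ^ k) (c * v₁ * v₂) :=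
        hasSum_coeff_mul_mul_pow_of_le hcB₁ hC₂ hz hv₁' hv₂'
      have hGv' : HasSum (fun k ↦ PowerSeries.coeff k (PowerSeries.map ι G) *
          (χ (cyclotomicGenerator p : ZMod (p ^ (m + 2))) - 1) ^ k) (c * v₁ * v₂) := by
        simp only [PowerSeries.coeff_map]
        exact hGv
      have hsub := hGv'.sub hPv
      rw [sub_self] at hsub
      have hfun : (fun i ↦ (RingHom.id ℂ_[p]) (PowerSeries.coeff i D) *
          (χ (cyclotomicGenerator p : ZMod (p ^ (m + 2))) - 1) ^ i) =
          fun i ↦ PowerSeries.coeff i (PowerSeries.map ι G) *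
            (χ (cyclotomicGenerator p : ZMod (p ^ (m + 2))) - 1) ^ i -
            PowerSeries.coeff i P * (χ (cyclotomicGenerator p : ZMod (p ^ (m + 2))) - 1) ^ i := by
        funext i
        rw [RingHom.id_apply, hD, map_sub, sub_mul]
      rw [hfun]
      exact hsub
  have hzero : D = 0 :=
    eq_zero_of_bounded_of_forall_character_hasSum_zero (RingHom.id ℂ_[p]) (fun _ _ h ↦ h) hDb hD0 hDz
  rw [hD, sub_eq_zero] at hzero
  rw [hzero, hP]

/-- Coefficient bookkeeping in `R⟦T⟧`: if `B₁(0) = 0` then `[T¹](c · B₁ · B₂) = c · [T¹]B₁ · B₂(0)`.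
[folklore] -/
private theorem coeff_one_C_mul_mul_of_constantCoeff_eq_zero' {R : Type*} [CommRing R] (c : R)
    (B₁ B₂ : PowerSeries R) (h0 : PowerSeries.constantCoeff B₁ = 0) :
    PowerSeries.coeff 1 (PowerSeries.C c * B₁ * B₂) =
      c * PowerSeries.coeff 1 B₁ * PowerSeries.constantCoeff B₂ := by
  rw [mul_assoc, PowerSeries.coeff_C_mul, PowerSeries.coeff_mul, Finset.Nat.antidiagonal_succ,
    Finset.sum_cons, Finset.Nat.antidiagonal_zero]
  simp [h0, mul_assoc]

/-- **Leading term of a factorised interpolant, constant in `ℂ_p`.** Under the hypotheses of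
`MemIwasawaRat.map_eq_C_mul_mul_of_forall_hasSum`, if `B₁(0) = 0` then
`ι([T¹]G) = c · ι([T¹]B₁) · ι(B₂(0))` — the rank-one shape (derivative of the product = `c` × derivative
of the vanishing factor × value of the other factor; Perrin-Riou 1987 §1.4 / PROOF-gz §3.4 (F″)).
[cite: MazurTateTeitelbaum1986Invent, §I.11 and §I.14 (14.3)] [cite: PerrinRiou1987, §1.4 (shape)] -/
theorem MemIwasawaRat.map_coeff_one_eq_of_forall_hasSum {G B₁ B₂ : PowerSeries ℚ_[p]}
    (hG : MemIwasawaRat p G) (hB₁ : MemIwasawaRat p B₁) (hB₂ : MemIwasawaRat p B₂) (c : ℂ_[p])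
    (h0 : algebraMap ℚ_[p] ℂ_[p] (PowerSeries.constantCoeff G) =
      c * algebraMap ℚ_[p] ℂ_[p] (PowerSeries.constantCoeff B₁) *
        algebraMap ℚ_[p] ℂ_[p] (PowerSeries.constantCoeff B₂))
    (h : ∀ (m : ℕ) (χ : DirichletCharacter ℂ_[p] (p ^ (m + 2))), χ.IsPrimitive → χ.Even →
      (∃ j : ℕ, orderOf χ = p ^ j) → ∀ v₁ v₂ : ℂ_[p],
        HasSum (fun i ↦ algebraMap ℚ_[p] ℂ_[p] (PowerSeries.coeff i B₁) *
          (χ (cyclotomicGenerator p : ZMod (p ^ (m + 2))) - 1) ^ i) v₁ →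
        HasSum (fun i ↦ algebraMap ℚ_[p] ℂ_[p] (PowerSeries.coeff i B₂) *
          (χ (cyclotomicGenerator p : ZMod (p ^ (m + 2))) - 1) ^ i) v₂ →
        HasSum (fun i ↦ algebraMap ℚ_[p] ℂ_[p] (PowerSeries.coeff i G) *
          (χ (cyclotomicGenerator p : ZMod (p ^ (m + 2))) - 1) ^ i) (c * v₁ * v₂))
    (hB0 : PowerSeries.constantCoeff B₁ = 0) :
    algebraMap ℚ_[p] ℂ_[p] (PowerSeries.coeff 1 G) =
      c * algebraMap ℚ_[p] ℂ_[p] (PowerSeries.coeff 1 B₁) *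
        algebraMap ℚ_[p] ℂ_[p] (PowerSeries.constantCoeff B₂) := by
  have hfac := hG.map_eq_C_mul_mul_of_forall_hasSum hB₁ hB₂ c h0 h
  have hB0' : PowerSeries.constantCoeff (PowerSeries.map (algebraMap ℚ_[p] ℂ_[p]) B₁) = 0 := by
    rw [← PowerSeries.coeff_zero_eq_constantCoeff_apply, PowerSeries.coeff_map,
      PowerSeries.coeff_zero_eq_constantCoeff_apply, hB0, map_zero]
  have hcc : PowerSeries.constantCoeff (PowerSeries.map (algebraMap ℚ_[p] ℂ_[p]) B₂) =
      algebraMap ℚ_[p] ℂ_[p] (PowerSeries.constantCoeff B₂) := by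
    rw [← PowerSeries.coeff_zero_eq_constantCoeff_apply, PowerSeries.coeff_map,
      PowerSeries.coeff_zero_eq_constantCoeff_apply]
  have h1 := congr_arg (PowerSeries.coeff 1) hfac
  rw [PowerSeries.coeff_map, coeff_one_C_mul_mul_of_constantCoeff_eq_zero' c _ _ hB0',
    PowerSeries.coeff_map, hcc] at h1
  exact h1

/-! ### The interpolant itself in `ℂ_p⟦T⟧` (a bounded "line function") -/

/-- **Factorisation of a BOUNDED `ℂ_p`-interpolant through a product of two elements of `Λ ⊗ ℚ_p`.**
Let `G ∈ ℂ_p⟦T⟧` have bounded coefficients, `B₁, B₂ ∈ Λ ⊗ ℚ_p`, `c ∈ ℂ_p`, `ι = algebraMap ℚ_p ℂ_p`.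
Suppose `G(0) = c · ι(B₁(0)) · ι(B₂(0))` and that for every `m` and every primitive even Dirichlet
character `χ` modulo `p^{m+2}` of `p`-power order with values in `ℂ_p`, whenever `B₁(χ(γ)-1) = v₁` and
`B₂(χ(γ)-1) = v₂` then `G(χ(γ)-1) = c · v₁ · v₂`. Then `G = c · ι(B₁) · ι(B₂)` in `ℂ_p⟦T⟧` — the shape
in which a `p`-adic `L`-function constructed over a finite extension of `ℚ_p` inside `ℂ_p` (Disegni
2017 Thm. A restricted to a line: a bounded element of `𝒪_L⟦T⟧ ⊗ L`, Lemma 10.2.1) is compared with a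
product of two Mazur–Tate–Teitelbaum branches (bounded-interpolant uniqueness over `ℂ_p`, all
conductors + the constant term; conductor `p` vacuous). [cite: MazurTateTeitelbaum1986Invent, §I.11 and §I.14 (14.3)]
[cite: Disegni2017, Lemma 10.2.1–10.2.2 (the receptacle) and Thm. A] -/
theorem eq_C_mul_map_mul_map_of_forall_hasSum_of_bounded {G : PowerSeries ℂ_[p]}
    {B₁ B₂ : PowerSeries ℚ_[p]} {CG : ℝ} (hG : ∀ k, ‖PowerSeries.coeff k G‖ ≤ CG)
    (hB₁ : MemIwasawaRat p B₁) (hB₂ : MemIwasawaRat p B₂) (c : ℂ_[p])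
    (h0 : PowerSeries.constantCoeff G =
      c * algebraMap ℚ_[p] ℂ_[p] (PowerSeries.constantCoeff B₁) *
        algebraMap ℚ_[p] ℂ_[p] (PowerSeries.constantCoeff B₂))
    (h : ∀ (m : ℕ) (χ : DirichletCharacter ℂ_[p] (p ^ (m + 2))), χ.IsPrimitive → χ.Even →
      (∃ j : ℕ, orderOf χ = p ^ j) → ∀ v₁ v₂ : ℂ_[p],
        HasSum (fun i ↦ algebraMap ℚ_[p] ℂ_[p] (PowerSeries.coeff i B₁) *
          (χ (cyclotomicGenerator p : ZMod (p ^ (m + 2))) - 1) ^ i) v₁ →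
        HasSum (fun i ↦ algebraMap ℚ_[p] ℂ_[p] (PowerSeries.coeff i B₂) *
          (χ (cyclotomicGenerator p : ZMod (p ^ (m + 2))) - 1) ^ i) v₂ →
        HasSum (fun i ↦ PowerSeries.coeff i G *
          (χ (cyclotomicGenerator p : ZMod (p ^ (m + 2))) - 1) ^ i) (c * v₁ * v₂)) :
    G = PowerSeries.C c * PowerSeries.map (algebraMap ℚ_[p] ℂ_[p]) B₁ *
        PowerSeries.map (algebraMap ℚ_[p] ℂ_[p]) B₂ := by
  set ι := algebraMap ℚ_[p] ℂ_[p] with hι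
  set P : PowerSeries ℂ_[p] := PowerSeries.C c * PowerSeries.map ι B₁ * PowerSeries.map ι B₂ with hP
  obtain ⟨C₁, hC₁⟩ := hB₁.exists_norm_coeff_map_le
  obtain ⟨C₂, hC₂⟩ := hB₂.exists_norm_coeff_map_le
  have hcB₁ : ∀ i, ‖PowerSeries.coeff i (PowerSeries.C c * PowerSeries.map ι B₁)‖ ≤ ‖c‖ * C₁ := fun i ↦ by
    rw [PowerSeries.coeff_C_mul, norm_mul]
    exact mul_le_mul_of_nonneg_left (hC₁ i) (norm_nonneg _)
  have hPb : ∀ k, ‖PowerSeries.coeff k P‖ ≤ ‖c‖ * C₁ * C₂ := norm_coeff_mul_le_mul_of_ultrametric hcB₁ hC₂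
  set D : PowerSeries ℂ_[p] := G - P with hD
  have hDb : ∀ k, ‖(RingHom.id ℂ_[p]) (PowerSeries.coeff k D)‖ ≤ max CG (‖c‖ * C₁ * C₂) := fun k ↦ by
    rw [RingHom.id_apply, hD, map_sub, sub_eq_add_neg]
    refine (IsUltrametricDist.norm_add_le_max _ _).trans ?_
    rw [norm_neg]
    exact max_le_max (hG k) (hPb k)
  have hcc : ∀ L : PowerSeries ℚ_[p], PowerSeries.constantCoeff (PowerSeries.map ι L) =
      ι (PowerSeries.constantCoeff L) := fun L ↦ by
    rw [← PowerSeries.coeff_zero_eq_constantCoeff_apply, PowerSeries.coeff_map,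
      PowerSeries.coeff_zero_eq_constantCoeff_apply]
  have hD0 : PowerSeries.constantCoeff D = 0 := by
    rw [hD, map_sub, hP, map_mul, map_mul, PowerSeries.constantCoeff_C, hcc, hcc, h0, sub_self]
  have hDz : ∀ m : ℕ, 0 < m → ∀ χ : DirichletCharacter ℂ_[p] (p ^ m), χ.IsPrimitive → χ.Even →
      (∃ j : ℕ, orderOf χ = p ^ j) →
        HasSum (fun i ↦ (RingHom.id ℂ_[p]) (PowerSeries.coeff i D) *
          (χ (cyclotomicGenerator p : ZMod (p ^ m)) - 1) ^ i) 0 := by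
    intro m hm χ hχ heven hord
    match m, hm with
    | 1, _ => exact absurd hχ (not_isPrimitive_of_orderOf_eq_prime_pow χ hord)
    | m + 2, _ =>
      have hz : ‖χ (cyclotomicGenerator p : ZMod (p ^ (m + 2))) - 1‖ < 1 :=
        norm_apply_cyclotomicGenerator_sub_one_lt χ hord
      obtain ⟨v₁, hv₁⟩ := hB₁.summable_eval hz
      obtain ⟨v₂, hv₂⟩ := hB₂.summable_eval hz
      have hGv := h m χ hχ heven hord v₁ v₂ hv₁ hv₂
      have hv₁' : HasSum (fun k ↦ PowerSeries.coeff k (PowerSeries.C c * PowerSeries.map ι B₁) *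
          (χ (cyclotomicGenerator p : ZMod (p ^ (m + 2))) - 1) ^ k) (c * v₁) := by
        have heq : (fun k ↦ PowerSeries.coeff k (PowerSeries.C c * PowerSeries.map ι B₁) *
            (χ (cyclotomicGenerator p : ZMod (p ^ (m + 2))) - 1) ^ k) =
            fun k ↦ c * (ι (PowerSeries.coeff k B₁) *
              (χ (cyclotomicGenerator p : ZMod (p ^ (m + 2))) - 1) ^ k) := by
          funext k
          rw [PowerSeries.coeff_C_mul, PowerSeries.coeff_map, mul_assoc]
        rw [heq]
        exact hv₁.mul_left c
      have hv₂' : HasSum (fun k ↦ PowerSeries.coeff k (PowerSeries.map ι B₂) *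
          (χ (cyclotomicGenerator p : ZMod (p ^ (m + 2))) - 1) ^ k) v₂ := by
        simp only [PowerSeries.coeff_map]
        exact hv₂
      have hPv : HasSum (fun k ↦ PowerSeries.coeff k P *
          (χ (cyclotomicGenerator p : ZMod (p ^ (m + 2))) - 1) ^ k) (c * v₁ * v₂) :=
        hasSum_coeff_mul_mul_pow_of_le hcB₁ hC₂ hz hv₁' hv₂'
      have hsub := hGv.sub hPv
      rw [sub_self] at hsub
      have hfun : (fun i ↦ (RingHom.id ℂ_[p]) (PowerSeries.coeff i D) *
          (χ (cyclotomicGenerator p : ZMod (p ^ (m + 2))) - 1) ^ i) =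
          fun i ↦ PowerSeries.coeff i G *
            (χ (cyclotomicGenerator p : ZMod (p ^ (m + 2))) - 1) ^ i -
            PowerSeries.coeff i P * (χ (cyclotomicGenerator p : ZMod (p ^ (m + 2))) - 1) ^ i := by
        funext i
        rw [RingHom.id_apply, hD, map_sub, sub_mul]
      rw [hfun]
      exact hsub
  have hzero : D = 0 :=
    eq_zero_of_bounded_of_forall_character_hasSum_zero (RingHom.id ℂ_[p]) (fun _ _ h ↦ h) hDb hD0 hDz
  rw [hD, sub_eq_zero] at hzero
  rw [hzero, hP]

/-- **Leading term, bounded `ℂ_p`-interpolant.** Under the hypotheses of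
`eq_C_mul_map_mul_map_of_forall_hasSum_of_bounded`, if `B₁(0) = 0` then
`[T¹]G = c · ι([T¹]B₁) · ι(B₂(0))`. [cite: MazurTateTeitelbaum1986Invent, §I.11 and §I.14 (14.3)]
[cite: PerrinRiou1987, §1.4 (shape)] -/
theorem coeff_one_eq_of_forall_hasSum_of_bounded {G : PowerSeries ℂ_[p]}
    {B₁ B₂ : PowerSeries ℚ_[p]} {CG : ℝ} (hG : ∀ k, ‖PowerSeries.coeff k G‖ ≤ CG)
    (hB₁ : MemIwasawaRat p B₁) (hB₂ : MemIwasawaRat p B₂) (c : ℂ_[p])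
    (h0 : PowerSeries.constantCoeff G =
      c * algebraMap ℚ_[p] ℂ_[p] (PowerSeries.constantCoeff B₁) *
        algebraMap ℚ_[p] ℂ_[p] (PowerSeries.constantCoeff B₂))
    (h : ∀ (m : ℕ) (χ : DirichletCharacter ℂ_[p] (p ^ (m + 2))), χ.IsPrimitive → χ.Even →
      (∃ j : ℕ, orderOf χ = p ^ j) → ∀ v₁ v₂ : ℂ_[p],
        HasSum (fun i ↦ algebraMap ℚ_[p] ℂ_[p] (PowerSeries.coeff i B₁) *
          (χ (cyclotomicGenerator p : ZMod (p ^ (m + 2))) - 1) ^ i) v₁ →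
        HasSum (fun i ↦ algebraMap ℚ_[p] ℂ_[p] (PowerSeries.coeff i B₂) *
          (χ (cyclotomicGenerator p : ZMod (p ^ (m + 2))) - 1) ^ i) v₂ →
        HasSum (fun i ↦ PowerSeries.coeff i G *
          (χ (cyclotomicGenerator p : ZMod (p ^ (m + 2))) - 1) ^ i) (c * v₁ * v₂))
    (hB0 : PowerSeries.constantCoeff B₁ = 0) :
    PowerSeries.coeff 1 G =
      c * algebraMap ℚ_[p] ℂ_[p] (PowerSeries.coeff 1 B₁) *
        algebraMap ℚ_[p] ℂ_[p] (PowerSeries.constantCoeff B₂) := by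
  have hfac := eq_C_mul_map_mul_map_of_forall_hasSum_of_bounded hG hB₁ hB₂ c h0 h
  have hB0' : PowerSeries.constantCoeff (PowerSeries.map (algebraMap ℚ_[p] ℂ_[p]) B₁) = 0 := by
    rw [← PowerSeries.coeff_zero_eq_constantCoeff_apply, PowerSeries.coeff_map,
      PowerSeries.coeff_zero_eq_constantCoeff_apply, hB0, map_zero]
  have hcc : PowerSeries.constantCoeff (PowerSeries.map (algebraMap ℚ_[p] ℂ_[p]) B₂) =
      algebraMap ℚ_[p] ℂ_[p] (PowerSeries.constantCoeff B₂) := by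
    rw [← PowerSeries.coeff_zero_eq_constantCoeff_apply, PowerSeries.coeff_map,
      PowerSeries.coeff_zero_eq_constantCoeff_apply]
  have h1 := congr_arg (PowerSeries.coeff 1) hfac
  rw [coeff_one_C_mul_mul_of_constantCoeff_eq_zero' c _ _ hB0', PowerSeries.coeff_map, hcc] at h1
  exact h1

end Literature.NumberTheory.EllipticCurves

end
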